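import Mathlib
import Literature.NumberTheory.Sieve.ShiuTheoremProofs
import Literature.NumberTheory.Sieve.PolynomialValuesSieveSequence
import Literature.NumberTheory.Sieve.SieveFrameworkUpperBound
import Literature.NumberTheory.Sieve.BoundedClassDensitySieveDimension
import Literature.NumberTheory.Sieve.PolynomialCongruencesMeanValues
import Literature.NumberTheory.Sieve.DivisorBound
import Literature.NumberTheory.LFunctions.MertensElementary
import Summits.Parity.BatemanHorn.Theorems.AlmostPrimeZerosSystemMertensCounting
import HarnessLib

/-!
# Nair–Tenenbaum light, I: weights bounded at prime powers and the values of `F`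

Crux `SystemLSDRealSegment` (stmt-Parity-11292, route `AlmostPrimeZeros`), line `beta-thinned-root-kernel`,
support programme of the lead c8: **Nair–Tenenbaum "light"** — the sharp-order upper bound
`Σ_{1≤n≤N} G(F(n)) ≤ C · N · exp(Σ_{p≤N} (G(p) − 1) ρ_F(p)/p)` for a polynomial `F ∈ ℤ[X]` (degree `≥ 1`, positive on
`ℕ_{≥1}`, root counts `ρ_F(p) ≤ D`, `ρ_F(p) < p`, `ρ_F(p^a) ≤ M`) and every weight `G ≥ 0`, `G(1) = 1`, multiplicative on
coprime arguments with `G(p^v) ≤ A` (M. Nair, Acta Arith. 62 (1992); Nair–Tenenbaum, Acta Math. 180 (1998), Thm 1 —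
the special case of the class bounded at prime powers), by Shiu's method (J. reine angew. Math. 313 (1980), §5) run on the
values `m = F(n)`: cut `m = c·d` at `√N` (`Shiu.cutPrime/cPart/dPart`), four classes, the beta upper-bound sieve of dimension
`2D` on the root classes of `c`, Hall–Tenenbaum's Theorem 01 and Rankin's trick with a uniform exponent for the `c`-sums.
Applied (file `…NairUpperBound`) to the product polynomial of a Bateman–Horn system with `G = y^{capped}` it gives
`Σ_{n≤x} y^{s_f(n)} ≪ x (log x)^{k(y−1)}`, i.e. `H_x(y) = O(1)` on the real segment — the upper half of the order of
magnitude predicted by the crux (lower half: `sumPowStat_lower_bound`, landed).  Everything here is PROVED; no definitions.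

This file: `G(m) ≤ A^{ω(m)} ≤ C m^δ`, `G(cd) ≤ G(c)A^{Ω(d)}`; fibres `#{n : F(n) = m} ≤ deg F`, small values, the coefficient height.
-/

open Finset Real Polynomial

namespace Summit.Parity.BatemanHorn.Cruxes.SystemLSDRealSegment.BetaThinnedRootKernel.Nair

open Literature.NumberTheory.Sieve

noncomputable section

/-! ## Part A. Weights bounded at prime powers; values of `F` -/

section Weights

variable {G : ℕ → ℝ} {A : ℝ}

/-- `G(m) ≤ A^{ω(m)}` for `m ≠ 0`. [folklore] -/
theorem weight_le_pow_card_primeFactors (hG0 : ∀ n, 0 ≤ G n) (hG1 : G 1 = 1)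
    (hGmul : ∀ m n : ℕ, m.Coprime n → G (m * n) = G m * G n)
    (hGA : ∀ p : ℕ, p.Prime → ∀ v : ℕ, 1 ≤ v → G (p ^ v) ≤ A) {m : ℕ} (hm : m ≠ 0) :
    G m ≤ A ^ #m.primeFactors := by
  rw [Nat.multiplicative_factorization G hGmul hG1 hm, Finsupp.prod, Nat.support_factorization,
    ← Finset.prod_const]
  refine Finset.prod_le_prod (fun p _ => hG0 _) fun p hp => ?_
  have hpp : p.Prime := Nat.prime_of_mem_primeFactors hp
  have h1 : 1 ≤ m.factorization p := by
    rw [← hpp.dvd_iff_one_le_factorization hm]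
    exact Nat.dvd_of_mem_primeFactors hp
  exact hGA p hpp _ h1

/-- `2^{ω(n)} ≤ τ(n)` for `n ≠ 0`. [folklore] -/
theorem two_pow_card_primeFactors_le_card_divisors {n : ℕ} (hn : n ≠ 0) :
    (2 : ℝ) ^ #n.primeFactors ≤ #n.divisors := by
  rw [Nat.card_divisors hn, ← Finset.prod_const]
  push_cast
  refine Finset.prod_le_prod (fun _ _ => by norm_num) fun p hp => ?_
  have h1 : 1 ≤ n.factorization p := by
    rw [← (Nat.prime_of_mem_primeFactors hp).dvd_iff_one_le_factorization hn]
    exact Nat.dvd_of_mem_primeFactors hp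
  have : (1 : ℝ) ≤ n.factorization p := by exact_mod_cast h1
  linarith

/-- `A^{ω(m)} ≤ C(A, δ) m^δ` (divisor bound). [folklore] -/
theorem exists_pow_card_primeFactors_le_rpow (hA : 1 ≤ A) {δ : ℝ} (hδ : 0 < δ) :
    ∃ C : ℝ, 1 ≤ C ∧ ∀ m : ℕ, 1 ≤ m → A ^ #m.primeFactors ≤ C * (m : ℝ) ^ δ := by
  set L : ℕ := ⌈A⌉₊
  have hL0 : 0 < L := Nat.ceil_pos.mpr (by linarith)
  have hLr : (0 : ℝ) < L := by exact_mod_cast hL0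
  have hAL : A ≤ (2 : ℝ) ^ L :=
    (Nat.le_ceil A).trans (by exact_mod_cast (Nat.lt_two_pow_self (n := L)).le)
  obtain ⟨C, hC1, hC⟩ := exists_sigma_zero_le_mul_rpow (ε := δ / L) (by positivity)
  refine ⟨C ^ L, one_le_pow₀ hC1, fun m hm => ?_⟩
  have hm0 : m ≠ 0 := by omega
  have h2 : (2 : ℝ) ^ #m.primeFactors ≤ #m.divisors := two_pow_card_primeFactors_le_card_divisors hm0
  have h3 : (#m.divisors : ℝ) ≤ C * (m : ℝ) ^ (δ / L) := by
    have := hC m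
    rwa [ArithmeticFunction.sigma_zero_apply] at this
  calc A ^ #m.primeFactors ≤ ((2 : ℝ) ^ L) ^ #m.primeFactors :=
        pow_le_pow_left₀ (by linarith) hAL _
    _ = ((2 : ℝ) ^ #m.primeFactors) ^ L := by rw [← pow_mul, mul_comm, pow_mul]
    _ ≤ (C * (m : ℝ) ^ (δ / L)) ^ L := pow_le_pow_left₀ (by positivity) (h2.trans h3) _
    _ = C ^ L * (m : ℝ) ^ δ := by
        rw [mul_pow, ← Real.rpow_natCast ((m : ℝ) ^ (δ / L)) L, ← Real.rpow_mul (by positivity),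
          div_mul_cancel₀ δ hLr.ne']

/-- `G(m) ≤ C(A, δ) m^δ`, uniformly over the class. [folklore] -/
theorem exists_weight_le_rpow (hA : 1 ≤ A) {δ : ℝ} (hδ : 0 < δ) :
    ∃ C : ℝ, 1 ≤ C ∧ ∀ G : ℕ → ℝ, (∀ n, 0 ≤ G n) → G 1 = 1 →
      (∀ m n : ℕ, m.Coprime n → G (m * n) = G m * G n) →
      (∀ p : ℕ, p.Prime → ∀ v : ℕ, 1 ≤ v → G (p ^ v) ≤ A) →
      ∀ m : ℕ, 1 ≤ m → G m ≤ C * (m : ℝ) ^ δ := by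
  obtain ⟨C, hC1, hC⟩ := exists_pow_card_primeFactors_le_rpow hA hδ
  exact ⟨C, hC1, fun G hG0 hG1 hGmul hGA m hm =>
    (weight_le_pow_card_primeFactors hG0 hG1 hGmul hGA (by omega)).trans (hC m hm)⟩

/-- `G(c·d) ≤ G(c) · A^{Ω(d)}` for coprime `c, d ≠ 0` (`Ω` = `Shiu.bigOmega`). [folklore] -/
theorem weight_mul_le (hG0 : ∀ n, 0 ≤ G n) (hG1 : G 1 = 1)
    (hGmul : ∀ m n : ℕ, m.Coprime n → G (m * n) = G m * G n)
    (hGA : ∀ p : ℕ, p.Prime → ∀ v : ℕ, 1 ≤ v → G (p ^ v) ≤ A) (hA : 1 ≤ A)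
    {c d : ℕ} (hcd : c.Coprime d) (hd : d ≠ 0) :
    G (c * d) ≤ G c * A ^ Shiu.bigOmega d := by
  rw [hGmul c d hcd]
  refine mul_le_mul_of_nonneg_left ?_ (hG0 c)
  refine Shiu.le_pow_bigOmega hG0 hG1 hGmul (fun p l hp hl => ?_) hd
  exact (hGA p hp l hl).trans (le_self_pow₀ hA (by omega))

end Weights

section Values

variable {F : ℤ[X]}

/-- `#{1 ≤ n ≤ N : F(n) = m} ≤ deg F` when `deg F ≥ 1`. [folklore] -/
theorem card_filter_eval_eq_le (hd : 1 ≤ F.natDegree) (N : ℕ) (m : ℤ) :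
    #((Icc 1 N).filter fun n : ℕ => F.eval (n : ℤ) = m) ≤ F.natDegree := by
  have hne : F - C m ≠ 0 := by
    intro h
    have := congrArg natDegree h
    rw [natDegree_sub_C, natDegree_zero] at this
    omega
  calc #((Icc 1 N).filter fun n : ℕ => F.eval (n : ℤ) = m)
      ≤ #((F - C m).roots.toFinset) := by
        refine Finset.card_le_card_of_injOn (fun n : ℕ => (n : ℤ)) (fun n hn => ?_) Nat.cast_injective.injOn
        rw [Finset.mem_coe, Finset.mem_filter] at hn
        rw [Finset.mem_coe, Multiset.mem_toFinset, mem_roots hne, IsRoot.def, eval_sub, eval_C, hn.2,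
          sub_self]
    _ ≤ Multiset.card (F - C m).roots := Multiset.toFinset_card_le _
    _ ≤ (F - C m).natDegree := card_roots' _
    _ = F.natDegree := natDegree_sub_C

/-- `#{1 ≤ n ≤ N : 0 < F(n) ≤ T} ≤ deg F · T`. [folklore] -/
theorem card_filter_eval_le_le (hd : 1 ≤ F.natDegree) (N T : ℕ) :
    #((Icc 1 N).filter fun n : ℕ => 0 < F.eval (n : ℤ) ∧ F.eval (n : ℤ) ≤ T) ≤ F.natDegree * T := by
  set S := (Icc 1 N).filter fun n : ℕ => 0 < F.eval (n : ℤ) ∧ F.eval (n : ℤ) ≤ T with hS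
  calc #S ≤ F.natDegree * #(S.image fun n : ℕ => F.eval (n : ℤ)) := by
        refine Finset.card_le_mul_card_image _ _ fun a _ => ?_
        calc #(S.filter fun n : ℕ => F.eval (n : ℤ) = a)
            ≤ #((Icc 1 N).filter fun n : ℕ => F.eval (n : ℤ) = a) := by
              refine Finset.card_le_card fun n hn => ?_
              simp only [hS, Finset.mem_filter] at hn ⊢
              exact ⟨hn.1.1, hn.2⟩
          _ ≤ F.natDegree := card_filter_eval_eq_le hd N a
    _ ≤ F.natDegree * T := by
        refine Nat.mul_le_mul_left _ ?_
        calc #(S.image fun n : ℕ => F.eval (n : ℤ)) ≤ #(Finset.Ioc (0 : ℤ) T) := by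
              refine Finset.card_le_card fun a ha => ?_
              simp only [hS, Finset.mem_image, Finset.mem_filter] at ha
              obtain ⟨n, ⟨_, h1, h2⟩, rfl⟩ := ha
              exact Finset.mem_Ioc.mpr ⟨h1, h2⟩
          _ = T := by simp

/-- The coefficient height `H(F) = Σ_j |a_j| ≥ 1` for `F ≠ 0`… in the form used: for `1 ≤ n ≤ N`,
`(F(n)).toNat ≤ H(F) · (N+1)^{deg F}` (the tree's `toNat_eval_le`, restated). [folklore] -/
theorem toNat_eval_le_height {n N : ℕ} (hn : n ≤ N) :
    (F.eval (n : ℤ)).toNat ≤ (∑ j ∈ range (F.natDegree + 1), (F.coeff j).natAbs) * (N + 1) ^ F.natDegree :=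
  Summit.Parity.BatemanHorn.Theorems.AlmostPrimeZeros.SystemMertens.toNat_eval_le F hn

end Values

/-- **Registered form** (`--supports stmt-Parity-11292`): the weight class is divisor-bounded: `G(m) ≤ C(A,δ) m^δ` uniformly. [folklore] -/
theorem nair_weight_le_rpow : ∀ (A : ℝ), 1 ≤ A → ∀ δ : ℝ, 0 < δ → ∃ C : ℝ, 1 ≤ C ∧ ∀ G : ℕ → ℝ, (∀ n, 0 ≤ G n) → G 1 = 1 → (∀ m n : ℕ, m.Coprime n → G (m * n) = G m * G n) → (∀ p : ℕ, p.Prime → ∀ v : ℕ, 1 ≤ v → G (p ^ v) ≤ A) → ∀ m : ℕ, 1 ≤ m → G m ≤ C * (m : ℝ) ^ δ :=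
  fun _A hA _δ hδ => exists_weight_le_rpow hA hδ

end

end Summit.Parity.BatemanHorn.Cruxes.SystemLSDRealSegment.BetaThinnedRootKernel.Nair
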